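import Summits.ABC.IUTFork.Joshi.GeometricCase1
import Summits.ABC.IUTFork.Joshi.GeometricCase1Schottky
import HarnessLib

/-!
# [J-III] §12.8, Schottky side: Thm. 12.8.5 (2)–(4), Rmk. 12.8.6; log-shifts and non-vacuity of Θgau-links (file 3 of slot T-35)

Block E of the abc-iut cell (rung LADDER-ABC:A2.E), seat abc-iut-E-t35, slot T-35 ([J-III] §12.1–12.8), file 3 of 3: the glue
between file 1 (`Joshi/GeometricCase1.lean`: `CoverSL2R`, `φ_∞`, log-links, `Level`, `alpha`, `tauPt`, `ThetaGauLink`) and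
file 2 (`Joshi/GeometricCase1Schottky.lean`: `lattice`, `schottky`, Schottky uniformization, `schottky_smul`,
`thetaDdot_pow_mul_I`). Node ids J3:Thm12.8.5 (2)(3)(4), J3:Rmk12.8.6 of plan/E/JOSHI-DAG.tsv. SOURCE: K. Joshi,
arXiv:2401.13508**v4** (unrefereed; bib `Joshi2024ATS3`), §12.8, PDF pp. 149–151; locators «p.N l.a–b» = PDF page / lines of
`HOME/lit/renders/Joshi-arxiv-2401.13508/pNNNN.txt`. OUR frozen `Cor312*`/`Thm311*` files are NOT imported (E-PLAN R14).

FRAMING (binding): TYPES a third party's unrefereed text for block E's test against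
`S = Summit.ABC.IUTFork.Cor312Vol.PilotKummerIndRelated`; NO side taken on [IUTchIII] Cor. 3.12, on Joshi's claims, or on
Mochizuki's report; typed ≠ proved; typed AS A CANDIDATE ≠ endorsed; nothing here bears on abc. Thm. 12.8.5 (2)(3) and
Rmk. 12.8.6 are PROVED ("Proof. The proof is clear from the previous lemmas", p.151 l.16); Thm. 12.8.5 (4) is OUR READING
(flag (F-c)): print says the tuple `(q^{1²/2ℓ}, …, q^{ℓ*²/2ℓ})` "corresponds to" the values of "a Θ-function as in
[Mochizuki, 2009]" at the `ℓ`-torsion points `P_j = j·P_1`; with `q̈ := e^{2π√−1τ/2ℓ}` (`q̈² = q_{E_{τ/ℓ}}`, print's "`τ′ = τ/ℓ`")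
and `P_j ↔ Ü = √−1·q̈^j`, [EtTh] Prop. 1.4 (ii) gives `Θ̈(P_j) = q_{τ,j}^{−1}·Θ̈(P_0)` (`thetaDdot_evalPoint`) — the tuple of (3)
up to inversion and the common factor `Θ̈(√−1)`; normalisation and exponent sign are ours (PARAPHRASE). Flag (F-a) (the
determination of `q^{j²/2ℓ}`) is moot here: `q_{τ,j} = q̈^{j²}` is an INTEGER power (`schottkyTuple_eq_pow`). DERIVED
extras: `ThetaGauLink.logShift` (log-links act on Θgau-links over the same `τ` — the vertical direction of the log-Θ-lattice,
§12.9 p.152 l.11–12), `CoverSL2R.thetaGauLink_nonempty` (Def. 12.8.3 is inhabited over `τ = 2ℓ√−1` for every interface).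
OUR-SIDE ANALOGUES (docstrings only; nothing bound): the tuple `q^{j²/2ℓ}` ↔ the Θ-pilot values `Cor312.Setting.thetaPilot`;
`q ↦ q^{j²}` ↔ [J-IIp] Thm. 6.9.1 valuation scaling (`ATS2.ValScaling`). No instance, notation, axiom or `sorry`.
-/

noncomputable section

open Complex UpperHalfPlane
open scoped MatrixGroups UpperHalfPlane Real

namespace Summit.ABC.IUTFork.Joshi.ATS3.Geo

/-! ## Lem. 12.7.3 for file 1's `scale` -/

/-- Lem. 12.7.3 (`schottky_smul`, file 2) for file 1's `scale a _ τ = a·τ`: `q_{E_{a·τ}} = exp(a · 2π√−1τ)`. -/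
theorem schottky_scale (a : ℝ) (ha : 0 < a) (τ : ℍ) :
    schottky (scale a ha τ) = cexp ((a : ℂ) * (2 * π * Complex.I * τ)) :=
  schottky_smul ⟨a, ha⟩ τ

/-- Integer case: `q_{E_{n·τ}} = q_{E_τ}^n`. -/
theorem schottky_scale_natCast (n : ℕ) (hn : 0 < (n : ℝ)) (τ : ℍ) :
    schottky (scale n hn τ) = schottky τ ^ n :=
  schottky_smul_natCast n hn τ

/-! ## §12.8, Schottky side (J3:Thm12.8.5 (2)(3)(4), Rmk12.8.6) -/


/-- The lattice `[1, j²τ/2ℓ]` of `E_{τ,j}` (p.149 l.38–40). -/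
def curveLattice (L : Level) (τ : ℍ) (j : L.Label) : AddSubgroup ℂ := lattice (tauPt L τ j : ℂ)

/-- **[J-III] Thm. 12.8.5 (2)** (p.150 l.43–45): "The elliptic curves `E_{τ,1}, …, E_{τ,ℓ*}` are all isogenous to `E_τ`."
PROVED from Lem. 12.7.1 with `α = j²/2ℓ ∈ ℚ_{>0}`. -/
theorem isIsogenousLattice_curveLattice (L : Level) (τ : ℍ) (j : L.Label) :
    IsIsogenousLattice (lattice (τ : ℂ)) (curveLattice L τ j) := by
  have hα : (0 : ℚ) < (L.jOf j : ℚ) ^ 2 / (2 * L.ell) := by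
    have h1 : (0 : ℚ) < L.jOf j := by exact_mod_cast Nat.succ_pos _
    have h2 : (0 : ℚ) < L.ell := by exact_mod_cast L.ell_pos
    positivity
  have key := isIsogenousLattice_smul (τ : ℂ) hα
  have hcoe : (((L.jOf j : ℚ) ^ 2 / (2 * L.ell) : ℚ) : ℂ) * (τ : ℂ) = (tauPt L τ j : ℂ) := by
    rw [tauPt, coe_scale]; push_cast; ring
  rwa [hcoe] at key

/-- **[J-III] Thm. 12.8.5 (3)** (p.151 l.1–3): "One has the tuple of the corresponding Schottky parameters
`(q_{τ,1}, q_{τ,2}, …, q_{τ,ℓ*}) ∈ (ℂ*)^{ℓ*}` corresponding to `E_{τ,1}, E_{τ,2}, …, E_{τ,ℓ*}`." — that tuple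
(nonvanishing: `schottkyTuple_ne_zero`). Our-side analogue (not bound): the Θ-pilot values `q^{j²/2ℓ}`, `Cor312.Setting.thetaPilot`. -/
def schottkyTuple (L : Level) (τ : ℍ) (j : L.Label) : ℂ := schottky (tauPt L τ j)

/-- Each `q_{τ,j} ∈ ℂ*`. -/
theorem schottkyTuple_ne_zero (L : Level) (τ : ℍ) (j : L.Label) : schottkyTuple L τ j ≠ 0 := schottky_ne_zero _

/-- `q_{τ,j} = q^{j²/2ℓ}` in the determination of flag (F-a): `= exp((j²/2ℓ) · 2π√−1τ)` (Lem. 12.7.3). -/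
theorem schottkyTuple_eq (L : Level) (τ : ℍ) (j : L.Label) :
    schottkyTuple L τ j = cexp ((((L.jOf j : ℝ) ^ 2 / (2 * L.ell) : ℝ) : ℂ) * (2 * π * Complex.I * τ)) :=
  schottky_scale _ _ τ

/-- `q̈ := q^{1/2ℓ} = e^{2π√−1τ/2ℓ}`, the Schottky parameter of `τ/2ℓ` (a `2ℓ`-th root of `q`; `q̈² = q_{E_{τ/ℓ}}` is the
Tate parameter of the curve "`τ′ = τ/ℓ`" of Thm. 12.8.5 (4)). -/
def qRoot (L : Level) (τ : ℍ) : ℂ := schottky (scale (1 / (2 * L.ell)) L.inv_two_ell_pos τ)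

/-- `q̈ ≠ 0`. -/
theorem qRoot_ne_zero (L : Level) (τ : ℍ) : qRoot L τ ≠ 0 := schottky_ne_zero _

/-- `|q̈| < 1`. -/
theorem norm_qRoot_lt_one (L : Level) (τ : ℍ) : ‖qRoot L τ‖ < 1 := norm_schottky_lt_one _

/-- EXACT form of "`q_{τ,j} = q^{j²/2ℓ}`": `q_{τ,j} = q̈^{j²}` with `q̈ = q^{1/2ℓ}` (integer exponent, no branch). -/
theorem schottkyTuple_eq_pow (L : Level) (τ : ℍ) (j : L.Label) :
    schottkyTuple L τ j = qRoot L τ ^ (L.jOf j ^ 2) := by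
  rw [schottkyTuple, qRoot, schottky, schottky, ← Complex.exp_nat_mul, tauPt, coe_scale, coe_scale]
  congr 1; push_cast; ring

/-- `q = q̈^{2ℓ}`. -/
theorem schottky_eq_qRoot_pow (L : Level) (τ : ℍ) : schottky τ = qRoot L τ ^ (2 * L.ell) := by
  rw [qRoot, schottky, schottky, ← Complex.exp_nat_mul, coe_scale]
  congr 1
  have hℓ : (L.ell : ℂ) ≠ 0 := by exact_mod_cast L.ell_pos.ne'
  push_cast; field_simp

open Literature.AnabelianGeometry.EtaleTheta in
/-- **[J-III] Thm. 12.8.5 (4) — OUR READING, flag (F-c)** (p.151 l.4–15): "Let `P_1` correspond to the `ℓ`-torsion point on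
the double cover `E_{τ/2}` of `E_τ` given by `τ′ = τ/ℓ` and choose a Θ-function as in [Mochizuki, 2009]. Then the above
tuple of Schottky parameters `(q_τ^{1²/2ℓ}, q_τ^{2²/2ℓ}, …, q_τ^{ℓ*²/2ℓ}) ∈ (ℂ*)^{ℓ*}` corresponds to the set of values of
the chosen Θ-function at the `ℓ`-torsion points `{P_j = j·P_1 ∈ E_{τ/2}[ℓ] : j = 1, 2, …, ℓ*}`." Kernel reading: with
Mochizuki's series `Θ̈` of [EtTh] Prop. 1.4 (`Literature.AnabelianGeometry.EtaleTheta.thetaDdot q̈ Ü`, `q̈² = q_X`),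
`q̈ = e^{2π√−1τ/2ℓ}` and `P_j ↔ Ü = √−1·q̈^j`, [EtTh] Prop. 1.4 (ii) (file 2's `thetaDdot_pow_mul_I`) gives
`Θ̈(P_j) = q_{τ,j}^{−1} · Θ̈(P_0)`: the values at the `P_j` are the INVERSES of the tuple of (3) times the common factor
`Θ̈(√−1)`. PROVED identity; the choice of `q̈`, of `Ü`, the inversion and the normalisation are ours ("corresponds to" is
not an identity in print). -/
theorem thetaDdot_evalPoint (L : Level) (τ : ℍ) (j : L.Label) :
    thetaDdot (qRoot L τ) (qRoot L τ ^ (L.jOf j : ℤ) * Complex.I) =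
      (schottkyTuple L τ j)⁻¹ * thetaDdot (qRoot L τ) Complex.I := by
  rw [thetaDdot_pow_mul_I (qRoot_ne_zero L τ), schottkyTuple_eq_pow]

/-- **[J-III] Rmk. 12.8.6** (p.151 l.17–31): "Since `α_j ∈ SL₂(ℚ) ⊂ GL₂⁺(ℚ)`, … one can think of a Θgau-Link as arising from
natural correspondences on the upper half plane in a manner similar to Hecke correspondences on classical modular curves.
By Lemma 12.7.3, these correspondences provide a (non-trivial) scaling `q_τ ↦ q_τ^{j²}` of the Schottky parameters. In the
`p`-adic case, [Joshi, 2023b] takes a similar approach via correspondences on suitable Fargues-Fontaine curves". PROVED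
(integer exponent, exact): the Schottky parameter of `α_j·τ` is `q_τ^{j²}`. Our-side analogue (not bound): the `j²` in
the Θ-pilot exponents / [J-IIp] Thm. 6.9.1 valuation scaling (`ATS2.ValScaling`, slot E-t2). -/
theorem schottky_alpha_smul (j : ℕ) (hj : j ≠ 0) (τ : ℍ) :
    schottky (alpha j hj • τ) = schottky τ ^ (j ^ 2) := by
  rw [alpha_smul, ← schottky_scale_natCast (j ^ 2) (by positivity) τ]
  congr 1
  exact scale_congr _ _ (by push_cast; ring) τ

/-! ## §12.9 support (derived): log-links act on Θgau-links fibrewise -/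

namespace CoverSL2R

variable {Y : Type*} [Group Y] (D : CoverSL2R Y)

/-- `SL₂(ℤ) ⊂ SL₂(ℚ)` lifts to `S̃L₂(ℤ) ≤ S̃L₂(ℚ)`. -/
theorem coverSL2Z_le_coverSL2Q : D.coverSL2Z ≤ D.coverSL2Q := by
  rintro g ⟨B, hB⟩
  refine (D.mem_coverSL2Q_iff g).mpr ⟨Matrix.SpecialLinearGroup.map (Int.castRingHom ℚ) B, ?_⟩
  rw [← hB]
  ext i j
  simp

/-- `φ_∞ ∈ S̃L₂(ℤ)` (it lies over `1 ∈ SL₂(ℤ)`). -/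
theorem phi_mem_coverSL2Z : D.phi ∈ D.coverSL2Z := ⟨1, by rw [map_one, pi_phi]⟩

/-- `φ_∞^m ∈ S̃L₂(ℚ)`. -/
theorem phi_zpow_mem_coverSL2Q (m : ℤ) : D.phi ^ m ∈ D.coverSL2Q :=
  Subgroup.zpow_mem _ (D.coverSL2Z_le_coverSL2Q D.phi_mem_coverSL2Z) m

variable {D}

/-- DERIVED (§12.9, p.152 l.11–12: "the fiber over `θ_n` consists of log-links … the horizontal direction being … Θgau-links"):
moving each member of a Θgau-link along its chain of log-links (`g̃_j ↦ g̃_j·φ_∞^{m_j}`) gives a Θgau-link over the SAME `τ`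
— the vertical direction of the log-Θ-lattice preserves Def. 12.8.3. -/
def ThetaGauLink.logShift {L : Level} (Λ : D.ThetaGauLink L) (m : L.Label → ℤ) : D.ThetaGauLink L where
  τ := Λ.τ
  g j := D.logLinkChain (Λ.g j) (m j)
  mem j := D.coverSL2Q.mul_mem (Λ.mem j) (D.phi_zpow_mem_coverSL2Q (m j))
  over j := by rw [toH_logLinkChain, Λ.over]

/-- The shifted link lies over the same `τ`. -/
theorem ThetaGauLink.logShift_τ {L : Level} (Λ : D.ThetaGauLink L) (m : L.Label → ℤ) : (Λ.logShift m).τ = Λ.τ := rfl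


/-! ## Non-vacuity of Def. 12.8.3 (derived) -/

variable (D)

/-- The image of `α_j ∈ SL₂(ℚ)` in `SL₂(ℝ)` acts on `ℍ` as `α_j` does (the `SL₂(ℚ) ⊂ SL₂(ℝ)` of Rmk. 12.8.1). -/
theorem map_alpha_smul (j : ℕ) (hj : j ≠ 0) (τ : ℍ) :
    (Matrix.SpecialLinearGroup.map (Rat.castHom ℝ) (alpha j hj) : SL(2, ℝ)) • τ = alpha j hj • τ := by
  ext1
  rw [coe_specialLinearGroup_apply, coe_specialLinearGroup_apply]
  simp [alpha]

/-- DERIVED non-vacuity of Def. 12.8.3 ("Existence of Θgau-links", the title of §12.8): over `τ = 2ℓ·√−1` the tuple of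
lifts of `(α_1, …, α_{ℓ*}) ∈ SL₂(ℚ)^{ℓ*}` is a Θgau-link, since `α_j·i = j²·i = j²τ/2ℓ` (lifts exist by surjectivity of
`Y_∞ → X_∞`). Print asserts existence only through the section title; recorded as a check that the typed definition is
inhabited for every interface `D` and level `ℓ`. -/
theorem thetaGauLink_nonempty (L : Level) : Nonempty (D.ThetaGauLink L) := by
  classical
  have hℓ := L.ell_pos_real
  choose g hg using fun j : L.Label =>
    D.proj_surjective (Matrix.SpecialLinearGroup.map (Rat.castHom ℝ) (alpha (L.jOf j) (Nat.succ_ne_zero _)))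
  refine ⟨{ τ := scale (2 * L.ell) (by positivity) UpperHalfPlane.I, g := g, mem := fun j => ?_, over := fun j => ?_ }⟩
  · exact (D.mem_coverSL2Q_iff _).mpr ⟨_, (hg j).symm⟩
  · rw [toH, toUpperHalf, hg, map_alpha_smul, alpha_smul, tauPt, scale_scale]
    exact scale_congr _ _ (by field_simp) _

end CoverSL2R

/-! ## Thm. 12.8.5 (2) in the printed direction (appended) -/

/-- Lem. 12.7.1, converse direction (isogeny of complex tori is symmetric): `E_{τ,α} → E_1`, witness
`den(α)·[1, α·τ] = [den(α), num(α)·τ] ⊆ [1, τ]` (any `α ∈ ℚ`). PROVED. -/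
theorem isIsogenousLattice_smul_symm (τ : ℂ) (α : ℚ) : IsIsogenousLattice (lattice ((α : ℂ) * τ)) (lattice τ) := by
  refine ⟨(α.den : ℂ), by exact_mod_cast α.den_ne_zero, fun x hx => ?_⟩
  obtain ⟨m, n, rfl⟩ := mem_lattice_iff.mp hx
  have hnum : (α : ℂ) * (α.den : ℂ) = (α.num : ℂ) := by
    have h := congrArg (fun q : ℚ => (q : ℂ)) (Rat.mul_den_eq_num α)
    push_cast at h
    exact h
  refine mem_lattice_iff.mpr ⟨m * α.den, n * α.num, ?_⟩
  push_cast
  rw [← hnum]; ring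

/-- **[J-III] Thm. 12.8.5 (2) in the PRINTED direction** ("`E_{τ,1}, …, E_{τ,ℓ*}` are all isogenous to `E_τ`", p.150
l.43–45): each `E_{τ,j} = ℂ/[1, j²τ/2ℓ]` maps isogenously TO `E_τ = ℂ/[1, τ]`. PROVED (with `isIsogenousLattice_curveLattice`
this gives both directions). -/
theorem isIsogenousLattice_curveLattice_symm (L : Level) (τ : ℍ) (j : L.Label) :
    IsIsogenousLattice (curveLattice L τ j) (lattice (τ : ℂ)) := by
  have key := isIsogenousLattice_smul_symm (τ : ℂ) ((L.jOf j : ℚ) ^ 2 / (2 * L.ell))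
  have hcoe : (((L.jOf j : ℚ) ^ 2 / (2 * L.ell) : ℚ) : ℂ) * (τ : ℂ) = (tauPt L τ j : ℂ) := by
    rw [tauPt, coe_scale]; push_cast; ring
  rwa [hcoe] at key

end Summit.ABC.IUTFork.Joshi.ATS3.Geo

end
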